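import Summits.CriticalPhenomena.PercolationContinuityZ3.Theorems.PercNearOneGluingNoHeavyQuantSliceLightBelow
import Summits.CriticalPhenomena.PercolationContinuityZ3.Theorems.PercNearOneGluingNoHeavyQuantFlowUncross
import HarnessLib

/-!
# QUANT lane R8, T-DEC: SPLITTING A DEC DATUM ALONG A SUB-FLOW — the residual flow stays a witness; the sub-flow's law is DEC without
# light straddlers when its pairs stay below the layer after the shift (brick B2 of Theorem C, LEAD-NOTES-G23 N50 (3))

builds on p205010 (kernel theorem, internal audit signed; external expert review pending)

Support file (`--supports stmt-CriticalPhenomena-4575`), QUANT lane lead seat prim-quant-lead (gen 23), rung R8 of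
`run/shared/lean/prim/quant/LADDER.md`.  One small definition (`subflowLaw`) and theorems; standard axioms, no sorries.

WHY.  Theorem C (N50 (3)) slices the part of the canonical flow running into mids `k` with `k + a ≤ j′` COMPONENTWISE (the (LB) case of
`BValidAt`, `slice_decAtT_of_bdecAtT'`) and routes the rest by `slice_isFlowAtT_of_deepLows_core`.  This file is the splitting step: for flows
`0 ≤ f_B ≤ f` with `IsFlowAtT x T j′ M ν f`,
* `subflowLaw x T j′ M f_B` = the law carried by the sub-flow (`k ↦ Σ_h f_B k h + Σ_l usage(l,k)·f_B l k`: its low mass plus the absorber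
  mass it consumes);
* **`isFlowAtT_residual_of_subflow`** — `f − f_B` is a witness for `ν − subflowLaw f_B` (same target, same layer);
* `subflowLaw_nonneg`, `residual_nonneg_of_subflow`;
* **`bdecAtT_subflowLaw`** — if every charged pair `(l, h)` of `f_B` has `h + a ≤ j′`, the normalised law `subflowLaw f_B / c`,
  `c = Σ f_B(l,h)/(1 − pairGate(l,h))` (= its mass, `subflowLaw_mass`), is `BDECAtT x T j′ M a` (components `{l, h; pairGate x T l h}`:
  heavy ones are `HValidAt`, light ones the (LB) disjunct with the ARCH discount at equality).

[this work]; nothing here is cited as a published result.  The gluing rows served [cite: KozmaNitzan2024, Conjecture 3 (p. 15)]; product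
measure [cite: Grimmett1999, §1.3 p. 10].
-/

noncomputable section

namespace Summit.CriticalPhenomena.PercolationContinuityZ3.Theorems

namespace Quant

open Finset

/-- the two-point law `{lo, hi; g}` (as in `…QuantLawDEC`) -/
local notation3 "TP[" lo ", " hi ", " g ", " h "]" =>
  (g : ℝ) * (if (h : ℕ) = (hi : ℕ) then (1 : ℝ) else 0) + (1 - (g : ℝ)) * (if (h : ℕ) = (lo : ℕ) then (1 : ℝ) else 0)

namespace LawDec

section Split

variable (x T : ℝ) (j' M : ℕ) (ν : ℕ → ℝ) (f fB : ℕ → ℕ → ℝ)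

/-- **the law carried by a sub-flow**: low mass shipped plus absorber mass consumed. [this work] -/
def subflowLaw (x T : ℝ) (j' M : ℕ) (fB : ℕ → ℕ → ℝ) : ℕ → ℝ :=
  fun k => (∑ h ∈ Finset.range (M + 1), fB k h) + ∑ l ∈ Finset.range (j' + 1), usage x T j' l k * fB l k

/-- a charged pair of the sub-flow is a charged pair of the flow: low source, absorber target, positive usage. -/
theorem subflow_pair (hx0 : 0 < x) (hx1 : x < 1) (hf : IsFlowAtT x T j' M ν f)
    (hle : ∀ l h, fB l h ≤ f l h) (l h : ℕ) (hp : 0 < fB l h) :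
    l ≤ j' ∧ 2 * (l : ℝ) < T ∧ h ≤ M ∧ (j' + 1 ≤ h ∨ T < (l : ℝ) + h) ∧ l < h ∧ 0 < usage x T j' l h := by
  obtain ⟨hl, hlow, hhM, hc⟩ := hf.2.1 l h (lt_of_lt_of_le hp (hle l h))
  have hlh : l < h := by
    rcases hc with hc | hc
    · omega
    · have : (l : ℝ) < h := by linarith
      exact_mod_cast this
  exact ⟨hl, hlow, hhM, hc, hlh, usage_pos_of_compat x T j' l h hx0 hx1 hlow hlh hc⟩

/-- no sub-flow enters a low: `Σ_l usage(l,k)·f_B l k = 0` for a low `k`. -/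
theorem subflow_col_low (hx0 : 0 < x) (hx1 : x < 1) (hf : IsFlowAtT x T j' M ν f) (h0 : ∀ l h, 0 ≤ fB l h)
    (hle : ∀ l h, fB l h ≤ f l h) (k : ℕ) (hk : k ≤ j') (hlow : 2 * (k : ℝ) < T) :
    ∑ l ∈ Finset.range (j' + 1), usage x T j' l k * fB l k = 0 := by
  refine Finset.sum_eq_zero fun l _ => ?_
  rcases (h0 l k).eq_or_lt with hz | hp
  · rw [← hz, mul_zero]
  · obtain ⟨-, hlow', -, hc, -, -⟩ := subflow_pair x T j' M ν f fB hx0 hx1 hf hle l k hp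
    exfalso
    rcases hc with hc | hc
    · omega
    · linarith

/-- no sub-flow leaves an absorber: `Σ_h f_B k h = 0` for an absorber `k`. -/
theorem subflow_row_abs (hx0 : 0 < x) (hx1 : x < 1) (hf : IsFlowAtT x T j' M ν f) (h0 : ∀ l h, 0 ≤ fB l h)
    (hle : ∀ l h, fB l h ≤ f l h) (k : ℕ) (hk : j' + 1 ≤ k ∨ T ≤ 2 * (k : ℝ)) :
    ∑ h ∈ Finset.range (M + 1), fB k h = 0 := by
  refine Finset.sum_eq_zero fun h _ => ?_
  rcases (h0 k h).eq_or_lt with hz | hp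
  · exact hz.symm
  · obtain ⟨hl, hlow, -, -, -, -⟩ := subflow_pair x T j' M ν f fB hx0 hx1 hf hle k h hp
    exfalso
    rcases hk with hk | hk
    · omega
    · linarith

/-- **THE RESIDUAL FLOW IS A WITNESS FOR THE RESIDUAL LAW.** [this work] -/
theorem isFlowAtT_residual_of_subflow (hx0 : 0 < x) (hx1 : x < 1) (hf : IsFlowAtT x T j' M ν f)
    (h0 : ∀ l h, 0 ≤ fB l h) (hle : ∀ l h, fB l h ≤ f l h) :
    IsFlowAtT x T j' M (fun k => ν k - subflowLaw x T j' M fB k) (fun l h => f l h - fB l h) := by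
  refine ⟨fun l h => by linarith [hle l h], ?_, ?_, ?_⟩
  · intro l h hp
    exact hf.2.1 l h (by linarith [h0 l h])
  · intro l hl hlow
    show ∑ h ∈ Finset.range (M + 1), (f l h - fB l h) = ν l - subflowLaw x T j' M fB l
    unfold subflowLaw
    rw [Finset.sum_sub_distrib, hf.2.2.1 l hl hlow, subflow_col_low x T j' M ν f fB hx0 hx1 hf h0 hle l hl hlow]
    ring
  · intro h hhM hc
    show ∑ l ∈ Finset.range (j' + 1), usage x T j' l h * (f l h - fB l h) ≤ ν h - subflowLaw x T j' M fB h
    unfold subflowLaw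
    rw [subflow_row_abs x T j' M ν f fB hx0 hx1 hf h0 hle h hc, zero_add]
    have e : ∑ l ∈ Finset.range (j' + 1), usage x T j' l h * (f l h - fB l h)
        = ∑ l ∈ Finset.range (j' + 1), usage x T j' l h * f l h - ∑ l ∈ Finset.range (j' + 1), usage x T j' l h * fB l h := by
      rw [← Finset.sum_sub_distrib]; exact Finset.sum_congr rfl fun l _ => by ring
    rw [e]
    linarith [hf.2.2.2 h hhM hc]

/-- the sub-flow's law is nonnegative. -/
theorem subflowLaw_nonneg (hx0 : 0 < x) (hx1 : x < 1) (hf : IsFlowAtT x T j' M ν f) (h0 : ∀ l h, 0 ≤ fB l h)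
    (hle : ∀ l h, fB l h ≤ f l h) (k : ℕ) : 0 ≤ subflowLaw x T j' M fB k := by
  unfold subflowLaw
  refine add_nonneg (Finset.sum_nonneg fun h _ => h0 k h) (Finset.sum_nonneg fun l _ => ?_)
  rcases (h0 l k).eq_or_lt with hz | hp
  · rw [← hz, mul_zero]
  · exact (mul_pos (subflow_pair x T j' M ν f fB hx0 hx1 hf hle l k hp).2.2.2.2.2 hp).le

/-- the residual law is nonnegative (law vanishing above `M`). -/
theorem residual_nonneg_of_subflow (hx0 : 0 < x) (hx1 : x < 1) (hνM : ∀ k, M < k → ν k = 0)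
    (hf : IsFlowAtT x T j' M ν f) (h0 : ∀ l h, 0 ≤ fB l h) (hle : ∀ l h, fB l h ≤ f l h) (k : ℕ) :
    0 ≤ ν k - subflowLaw x T j' M fB k := by
  have hR := isFlowAtT_residual_of_subflow x T j' M ν f fB hx0 hx1 hf h0 hle
  by_cases hkM : k ≤ M
  · by_cases hlow : k ≤ j' ∧ 2 * (k : ℝ) < T
    · have := hR.2.2.1 k hlow.1 hlow.2
      simp only at this
      rw [← this]
      exact Finset.sum_nonneg fun h _ => hR.1 k h
    · have hc : j' + 1 ≤ k ∨ T ≤ 2 * (k : ℝ) := by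
        by_cases hkj : k ≤ j'
        · exact Or.inr (not_lt.1 fun h => hlow ⟨hkj, h⟩)
        · exact Or.inl (by omega)
      have := hR.2.2.2 k hkM hc
      simp only at this
      refine le_trans (Finset.sum_nonneg fun l _ => ?_) this
      rcases (hR.1 l k).eq_or_lt with hz | hp
      · simp only at hz; rw [← hz, mul_zero]
      · obtain ⟨hl', hlow', -, hc'⟩ := hR.2.1 l k hp
        have hlk : l < k := by
          rcases hc' with hc' | hc'
          · omega
          · have : (l : ℝ) < k := by linarith
            exact_mod_cast this
        exact (mul_pos (usage_pos_of_compat x T j' l k hx0 hx1 hlow' hlk hc') hp).le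
  · have hkM' : M < k := by omega
    have hz1 : ∑ h ∈ Finset.range (M + 1), fB k h = 0 := by
      refine Finset.sum_eq_zero fun h _ => ?_
      rcases (h0 k h).eq_or_lt with hz | hp
      · exact hz.symm
      · obtain ⟨hl, hlow, -, -, -, -⟩ := subflow_pair x T j' M ν f fB hx0 hx1 hf hle k h hp
        have := hf.2.2.1 k hl hlow
        rw [hνM k hkM'] at this
        have hfk : f k h ≤ ∑ h' ∈ Finset.range (M + 1), f k h' :=
          Finset.single_le_sum (f := fun h' => f k h') (fun h' _ => hf.1 k h') (Finset.mem_range.2 (by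
            have := (hf.2.1 k h (lt_of_lt_of_le hp (hle k h))).2.2.1; omega))
        linarith [hle k h]
    have hz2 : ∑ l ∈ Finset.range (j' + 1), usage x T j' l k * fB l k = 0 := by
      refine Finset.sum_eq_zero fun l _ => ?_
      rcases (h0 l k).eq_or_lt with hz | hp
      · rw [← hz, mul_zero]
      · obtain ⟨-, -, hkM2, -⟩ := subflow_pair x T j' M ν f fB hx0 hx1 hf hle l k hp
        omega
    unfold subflowLaw
    rw [hz1, hz2, hνM k hkM']
    norm_num

/-- rows of the sub-flow vanish off the lows `≤ min(j′, M)` (law vanishing above `M`). -/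
theorem subflow_row_eq_zero (hx0 : 0 < x) (hx1 : x < 1) (hνM : ∀ k, M < k → ν k = 0) (hf : IsFlowAtT x T j' M ν f)
    (h0 : ∀ l h, 0 ≤ fB l h) (hle : ∀ l h, fB l h ≤ f l h) (k : ℕ) (hk : j' < k ∨ M < k) (h : ℕ) : fB k h = 0 := by
  rcases (h0 k h).eq_or_lt with hz | hp
  · exact hz.symm
  · obtain ⟨hl, hlow, hhM, -, -, -⟩ := subflow_pair x T j' M ν f fB hx0 hx1 hf hle k h hp
    exfalso
    rcases hk with hk | hk
    · omega
    · have hrow := hf.2.2.1 k hl hlow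
      rw [hνM k hk] at hrow
      have hfk : f k h ≤ ∑ h' ∈ Finset.range (M + 1), f k h' :=
        Finset.single_le_sum (f := fun h' => f k h') (fun h' _ => hf.1 k h') (Finset.mem_range.2 (by omega))
      linarith [hle k h]

/-- **the mass of the sub-flow's law** is `Σ f_B(l,h)/(1 − pairGate(l,h))`, provided every charged pair is a mid pair (`h ≤ j′`). [this work] -/
theorem subflowLaw_mass (hx0 : 0 < x) (hx1 : x < 1) (hνM : ∀ k, M < k → ν k = 0) (hf : IsFlowAtT x T j' M ν f)
    (h0 : ∀ l h, 0 ≤ fB l h) (hle : ∀ l h, fB l h ≤ f l h) (hmid : ∀ l h, 0 < fB l h → h ≤ j') :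
    ∑ k ∈ Finset.range (M + 1), subflowLaw x T j' M fB k
      = ∑ l ∈ Finset.range (j' + 1), ∑ h ∈ Finset.range (M + 1), fB l h / (1 - pairGate x T l h) := by
  have hterm : ∀ l h, fB l h / (1 - pairGate x T l h) = fB l h + usage x T j' l h * fB l h := by
    intro l h
    rcases (h0 l h).eq_or_lt with hz | hp
    · rw [← hz]; simp
    · obtain ⟨-, hlow, -, hc, hlh, -⟩ := subflow_pair x T j' M ν f fB hx0 hx1 hf hle l h hp
      have hhj := hmid l h hp
      have hcomp : T < (l : ℝ) + h := by
        rcases hc with hc | hc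
        · omega
        · exact hc
      have hγ1 := pairGate_lt_one x T l h hx0 hx1 hlow hcomp
      have hne : (1:ℝ) - pairGate x T l h ≠ 0 := ne_of_gt (by linarith)
      unfold usage gateOf
      rw [if_neg (by omega), div_eq_iff hne]
      field_simp
      ring
  simp_rw [hterm]
  have hrow0 : ∀ k h, (j' < k ∨ M < k) → fB k h = 0 := fun k h hk =>
    subflow_row_eq_zero x T j' M ν f fB hx0 hx1 hνM hf h0 hle k hk h
  set K := max M j' with hK
  have ea : ∑ k ∈ Finset.range (M + 1), ∑ h ∈ Finset.range (M + 1), fB k h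
      = ∑ l ∈ Finset.range (j' + 1), ∑ h ∈ Finset.range (M + 1), fB l h := by
    have eM : ∑ k ∈ Finset.range (M + 1), ∑ h ∈ Finset.range (M + 1), fB k h
        = ∑ k ∈ Finset.range (K + 1), ∑ h ∈ Finset.range (M + 1), fB k h :=
      Finset.sum_subset (Finset.range_mono (by omega)) fun k hk hnk => by
        rw [Finset.mem_range] at hk hnk
        exact Finset.sum_eq_zero fun h _ => hrow0 k h (Or.inr (by omega))
    have eJ : ∑ k ∈ Finset.range (j' + 1), ∑ h ∈ Finset.range (M + 1), fB k h
        = ∑ k ∈ Finset.range (K + 1), ∑ h ∈ Finset.range (M + 1), fB k h :=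
      Finset.sum_subset (Finset.range_mono (by omega)) fun k hk hnk => by
        rw [Finset.mem_range] at hk hnk
        exact Finset.sum_eq_zero fun h _ => hrow0 k h (Or.inl (by omega))
    rw [eM, eJ]
  have eb : ∑ k ∈ Finset.range (M + 1), ∑ l ∈ Finset.range (j' + 1), usage x T j' l k * fB l k
      = ∑ l ∈ Finset.range (j' + 1), ∑ h ∈ Finset.range (M + 1), usage x T j' l h * fB l h := Finset.sum_comm
  unfold subflowLaw
  rw [Finset.sum_add_distrib, ea, eb, ← Finset.sum_add_distrib]
  exact Finset.sum_congr rfl fun l _ => by rw [← Finset.sum_add_distrib]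

/-- **THE SUB-FLOW'S LAW IS DEC WITHOUT LIGHT STRADDLERS** when every charged pair stays below the layer after the shift (`h + a ≤ j′`):
components `{l, h; pairGate x T l h}` with weights `f_B(l,h)/((1 − pairGate)·c)`. [this work] -/
theorem bdecAtT_subflowLaw (hx0 : 0 < x) (hx1 : x < 1) (hνM : ∀ k, M < k → ν k = 0) (hf : IsFlowAtT x T j' M ν f)
    (h0 : ∀ l h, 0 ≤ fB l h) (hle : ∀ l h, fB l h ≤ f l h) (a : ℕ) (hB : ∀ l h, 0 < fB l h → h + a ≤ j')
    (c : ℝ) (hc : c = ∑ l ∈ Finset.range (j' + 1), ∑ h ∈ Finset.range (M + 1), fB l h / (1 - pairGate x T l h))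
    (hcpos : 0 < c) :
    BDECAtT x T j' M a (fun k => subflowLaw x T j' M fB k / c) := by
  classical
  have ch : ∀ l h, 0 < fB l h → l ≤ j' ∧ 2 * (l : ℝ) < T ∧ h ≤ M ∧ T < (l : ℝ) + h ∧ l < h ∧ h ≤ j' ∧
      0 < pairGate x T l h ∧ pairGate x T l h < 1 ∧ usage x T j' l h = pairGate x T l h / (1 - pairGate x T l h) := by
    intro l h hp
    obtain ⟨hl, hlow, hhM, hcmp, hlh, -⟩ := subflow_pair x T j' M ν f fB hx0 hx1 hf hle l h hp
    have hhj : h ≤ j' := by have := hB l h hp; omega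
    have hcomp : T < (l : ℝ) + h := by
      rcases hcmp with hcmp | hcmp
      · omega
      · exact hcmp
    refine ⟨hl, hlow, hhM, hcomp, hlh, hhj, pairGate_pos x T l h hlow hlh, pairGate_lt_one x T l h hx0 hx1 hlow hcomp, ?_⟩
    unfold usage gateOf; rw [if_neg (by omega)]
  refine ⟨Fin (j' + 1) × Fin (M + 1), inferInstance,
    fun r => fB r.1 r.2 / ((1 - pairGate x T r.1 r.2) * c),
    fun r => if 0 < fB r.1 r.2 then pairGate x T r.1 r.2 else 0,
    fun r => if 0 < fB r.1 r.2 then (r.1 : ℕ) else 0,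
    fun r => if 0 < fB r.1 r.2 then (r.2 : ℕ) else 0,
    ?_, ?_, ?_, ?_, ?_, ?_, ?_⟩
  · -- weights ≥ 0
    intro r
    show 0 ≤ fB r.1 r.2 / ((1 - pairGate x T r.1 r.2) * c)
    rcases (h0 r.1 r.2).eq_or_lt with hz | hp
    · rw [← hz, zero_div]
    · obtain ⟨-, -, -, -, -, -, -, hγ1, -⟩ := ch r.1 r.2 hp
      exact div_nonneg hp.le (mul_nonneg (by linarith) hcpos.le)
  · -- weights sum to 1
    show ∑ r : Fin (j' + 1) × Fin (M + 1), fB r.1 r.2 / ((1 - pairGate x T r.1 r.2) * c) = 1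
    have conv : ∑ r : Fin (j' + 1) × Fin (M + 1), fB r.1 r.2 / ((1 - pairGate x T r.1 r.2) * c)
        = ∑ l ∈ Finset.range (j' + 1), ∑ h ∈ Finset.range (M + 1), fB l h / ((1 - pairGate x T l h) * c) := by
      rw [Fintype.sum_prod_type, ← Fin.sum_univ_eq_sum_range
        (fun l => ∑ h ∈ Finset.range (M + 1), fB l h / ((1 - pairGate x T l h) * c)) (j' + 1)]
      refine Fintype.sum_congr _ _ fun i => ?_
      exact Fin.sum_univ_eq_sum_range (fun h => fB i h / ((1 - pairGate x T i h) * c)) (M + 1)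
    rw [conv]
    have e : ∀ l h, fB l h / ((1 - pairGate x T l h) * c) = (fB l h / (1 - pairGate x T l h)) / c := fun l h => by
      rw [div_div]
    simp only [e, ← Finset.sum_div]
    rw [← hc, div_self hcpos.ne']
  · -- gates in [0,1]
    intro r
    dsimp only
    by_cases hp : 0 < fB r.1 r.2
    · obtain ⟨-, -, -, -, -, -, hγ0, hγ1, -⟩ := ch r.1 r.2 hp
      rw [if_pos hp]; exact ⟨hγ0.le, hγ1.le⟩
    · rw [if_neg hp]; exact ⟨le_rfl, zero_le_one⟩
  · -- lo ≤ hi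
    intro r
    dsimp only
    by_cases hp : 0 < fB r.1 r.2
    · obtain ⟨-, -, -, -, hlh, -⟩ := ch r.1 r.2 hp
      rw [if_pos hp, if_pos hp]; exact hlh.le
    · rw [if_neg hp, if_neg hp]
  · -- hi ≤ M
    intro r
    dsimp only
    by_cases hp : 0 < fB r.1 r.2
    · rw [if_pos hp]; exact Nat.lt_succ_iff.1 r.2.is_lt
    · rw [if_neg hp]; exact Nat.zero_le _
  · -- the law identity
    intro k
    have conv : ∑ r : Fin (j' + 1) × Fin (M + 1), fB r.1 r.2 / ((1 - pairGate x T r.1 r.2) * c) *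
        TP[(if 0 < fB r.1 r.2 then (r.1 : ℕ) else 0), (if 0 < fB r.1 r.2 then (r.2 : ℕ) else 0),
          (if 0 < fB r.1 r.2 then pairGate x T r.1 r.2 else 0), k]
        = ∑ l ∈ Finset.range (j' + 1), ∑ h ∈ Finset.range (M + 1), fB l h / ((1 - pairGate x T l h) * c) *
          TP[(if 0 < fB l h then l else 0), (if 0 < fB l h then h else 0), (if 0 < fB l h then pairGate x T l h else 0), k] := by
      rw [Fintype.sum_prod_type, ← Fin.sum_univ_eq_sum_range
        (fun l => ∑ h ∈ Finset.range (M + 1), fB l h / ((1 - pairGate x T l h) * c) *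
          TP[(if 0 < fB l h then l else 0), (if 0 < fB l h then h else 0), (if 0 < fB l h then pairGate x T l h else 0), k]) (j' + 1)]
      refine Fintype.sum_congr _ _ fun i => ?_
      exact Fin.sum_univ_eq_sum_range (fun h => fB i h / ((1 - pairGate x T i h) * c) *
          TP[(if 0 < fB i h then (i : ℕ) else 0), (if 0 < fB i h then h else 0), (if 0 < fB i h then pairGate x T i h else 0), k]) (M + 1)
    show subflowLaw x T j' M fB k / c = ∑ r : Fin (j' + 1) × Fin (M + 1), fB r.1 r.2 / ((1 - pairGate x T r.1 r.2) * c) *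
        TP[(if 0 < fB r.1 r.2 then (r.1 : ℕ) else 0), (if 0 < fB r.1 r.2 then (r.2 : ℕ) else 0),
          (if 0 < fB r.1 r.2 then pairGate x T r.1 r.2 else 0), k]
    rw [conv]
    have et : ∀ l h, fB l h / ((1 - pairGate x T l h) * c) *
        TP[(if 0 < fB l h then l else 0), (if 0 < fB l h then h else 0), (if 0 < fB l h then pairGate x T l h else 0), k]
        = (usage x T j' l h * fB l h * (if k = h then (1:ℝ) else 0) + fB l h * (if k = l then (1:ℝ) else 0)) / c := by
      intro l h
      rcases (h0 l h).eq_or_lt with hz | hp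
      · rw [← hz]; simp
      · obtain ⟨-, -, -, -, -, -, -, hγ1, hu⟩ := ch l h hp
        have hne : (1:ℝ) - pairGate x T l h ≠ 0 := ne_of_gt (by linarith)
        have hcne : c ≠ 0 := hcpos.ne'
        rw [if_pos hp, if_pos hp, if_pos hp, hu]
        rw [div_mul_eq_mul_div, div_eq_div_iff (mul_ne_zero hne hcne) hcne]
        field_simp
    simp only [et, ← Finset.sum_div]
    congr 1
    have hcolz : ∀ l, M < k → fB l k = 0 := by
      intro l hk
      rcases (h0 l k).eq_or_lt with hz | hp'
      · exact hz.symm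
      · exact absurd (subflow_pair x T j' M ν f fB hx0 hx1 hf hle l k hp').2.2.1 (by omega)
    have eA : ∑ l ∈ Finset.range (j' + 1), ∑ h ∈ Finset.range (M + 1),
        usage x T j' l h * fB l h * (if k = h then (1:ℝ) else 0) = ∑ l ∈ Finset.range (j' + 1), usage x T j' l k * fB l k := by
      refine Finset.sum_congr rfl fun l _ => ?_
      rw [show (∑ h ∈ Finset.range (M + 1), usage x T j' l h * fB l h * (if k = h then (1:ℝ) else 0))
          = ∑ h ∈ Finset.range (M + 1), (if k = h then usage x T j' l h * fB l h else 0) from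
            Finset.sum_congr rfl fun h _ => by split_ifs <;> ring,
        Finset.sum_ite_eq]
      split_ifs with hk
      · rfl
      · rw [Finset.mem_range] at hk
        rw [hcolz l (by omega), mul_zero]
    have eB : ∑ l ∈ Finset.range (j' + 1), ∑ h ∈ Finset.range (M + 1), fB l h * (if k = l then (1:ℝ) else 0)
        = ∑ h ∈ Finset.range (M + 1), fB k h := by
      rw [Finset.sum_comm]
      refine Finset.sum_congr rfl fun h _ => ?_
      rw [show (∑ l ∈ Finset.range (j' + 1), fB l h * (if k = l then (1:ℝ) else 0))
          = ∑ l ∈ Finset.range (j' + 1), (if k = l then fB l h else 0) from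
            Finset.sum_congr rfl fun l _ => by split_ifs <;> ring,
        Finset.sum_ite_eq]
      split_ifs with hk
      · rfl
      · rw [Finset.mem_range] at hk
        exact (subflow_row_eq_zero x T j' M ν f fB hx0 hx1 hνM hf h0 hle k (Or.inl (by omega)) h).symm
    unfold subflowLaw
    rw [Finset.sum_congr rfl (fun l _ => Finset.sum_add_distrib), Finset.sum_add_distrib, eA, eB, add_comm]
  · -- validity without light straddlers
    intro r hr
    dsimp only at hr ⊢
    have hp : 0 < fB r.1 r.2 := by
      by_contra hnp
      have hz : fB r.1 r.2 = 0 := le_antisymm (not_lt.1 hnp) (h0 _ _)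
      rw [hz, zero_div] at hr
      exact lt_irrefl _ hr
    obtain ⟨hl, hlow, hhM, hcomp, hlh, hhj, hγ0, hγ1, -⟩ := ch r.1 r.2 hp
    have hBa := hB r.1 r.2 hp
    rw [if_pos hp, if_pos hp, if_pos hp]
    set l : ℕ := (r.1 : ℕ) with hl_def
    set h : ℕ := (r.2 : ℕ) with hh_def
    have hml : (0:ℝ) < (h:ℝ) - l := by
      have : (l:ℝ) < h := by exact_mod_cast hlh
      linarith
    set ρ := (T - 2 * (l : ℝ)) / ((h : ℝ) - l) with hρ
    have hγ : pairGate x T l h = max ρ (x ^ 2 + (1 - x) * ρ) := rfl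
    by_cases hheavy : x ≤ pairGate x T l h
    · refine Or.inl (Or.inr (Or.inr ⟨hlh, hhj, hheavy, ?_⟩))
      have hρle : ρ ≤ pairGate x T l h := by rw [hγ]; exact le_max_left _ _
      have : T - 2 * (l:ℝ) ≤ ((h:ℝ) - l) * pairGate x T l h := by
        have := mul_le_mul_of_nonneg_left hρle hml.le
        rwa [hρ, mul_div_cancel₀ _ hml.ne'] at this
      linarith
    · have hlt : pairGate x T l h < x := not_le.1 hheavy
      refine Or.inr (Or.inr ⟨hlh, hBa, ?_, hlt, ?_⟩)
      · have hρ0 : 0 < ρ := div_pos (by linarith) hml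
        have : x ^ 2 + (1 - x) * ρ ≤ pairGate x T l h := by rw [hγ]; exact le_max_right _ _
        nlinarith
      · have hρx : ρ < x := lt_of_le_of_lt (by rw [hγ]; exact le_max_left _ _) hlt
        have hγeq : pairGate x T l h = x ^ 2 + (1 - x) * ρ := by
          rw [hγ]; refine max_eq_right ?_; nlinarith
        rw [hγeq]
        have h1x : (1:ℝ) - x ≠ 0 := ne_of_gt (by linarith)
        have e : (x ^ 2 + (1 - x) * ρ - x ^ 2) / (1 - x) = ρ := by field_simp; ring
        rw [e, hρ, mul_div_cancel₀ _ hml.ne']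
        linarith

end Split

end LawDec

end Quant

end Summit.CriticalPhenomena.PercolationContinuityZ3.Theorems
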